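import Literature.NumberTheory.Automorphic.Liu2021.Def411WeilCarriersAtLineClassTransport
import HarnessLib

/-!
# Crux `H413` — the socket (C′) `rhoAtLine_lineClassTransport` FROM the line-class transport MASTER equivalence (programme P4's S4a road)

HC_CM is proved only modulo the 7 printed citations until rung 0 closes.

F0P2-p02 (g0), 2026-08-30 (F0P2-plan (g0) word 22:53:30Z (β′); F0P4-plan (g2) 22:38:59Z ∕ 22:54:30Z «ONE PROOF CLOSES BOTH»: the MASTER
`lineClassTransport_equiv` — an `U(diag dV)(𝔸_{L⁺,f})`-equivariant LINEAR EQUIVALENCE `omegaAtLine … a χ ≃ₗ[ℂ] omegaAtLine … a′ χ` at the `χ_V`-splittings whenever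
`locF a = locF a′`, general rank, `Type`-level `L` — closes P4's stub S4a `StubT3aLineTransportAt` AND P2's socket (C′)).  PROOF FILE (one theorem, no `def`, no `sorry`)
for crux item `stmt-HodgeConjecture-24833`.

WHAT IS PROVED.  `rhoAtLine_lineClassTransport_of_equiv (hLT) : Def411WeilCarriers.rhoAtLine_lineClassTransport` where the hypothesis `hLT` IS the master's statement
shape as worded by F0P4-plan (g2) 22:38:59Z at (C′)'s own Literature telescope (`∀ L [IsCMField L] {N′ n′} e₁ dV hdV hdV0 χV hχu hχs χ a a′, locF a = locF a′ →
∃ Ψ : omegaAtLine … a χ ≃ₗ[ℂ] omegaAtLine … a′ χ, ∀ k x, Ψ (rhoVAtLine … a χ k x) = rhoVAtLine … a′ χ k (Ψ x)`): the equivalence is injective and, `rhoAtLine … ιV` being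
`rhoVAtLine ∘ ιV` (`rfl`, ★ `rhoAtLine_apply`), intertwines the pulled-back actions for EVERY `ιV : G →* U(diag dV)(𝔸_{L⁺,f})`.  When the master lands (★ name `lineClassTransport_equiv`,
owner F0P4-p06 (g0)'s S4a road), `theorem rhoAtLine_lineClassTransport_holds := rhoAtLine_lineClassTransport_of_equiv lineClassTransport_equiv` discharges (C′) (`ledger fact claim`).

Sources: [Liu2021, App. D §D.1 Step 1 footnote (l. 5215)]; [Jacobowitz1962, Thm. 3.1]; [MVW1987, Ch. 3 §I]; [Kudla1994, §1–3]; [HarrisKudlaSweet1996, §1].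
-/

set_option autoImplicit false

-- the mandated namespace has the single-problem summit's repeated segment (`HodgeConjecture.HodgeConjecture`), as in every `Cruxes/…` module of this sub-problem
set_option linter.dupNamespace false

noncomputable section

namespace Summit.HodgeConjecture.HodgeConjecture.Cruxes.H413.LineClassTransport

open NumberField IsDedekindDomain
open scoped Matrix
open Literature.NumberTheory.Automorphic Literature.NumberTheory.Automorphic.UnitaryGroup
open Literature.NumberTheory.Automorphic.Liu2021.Def411WeilCarriers
open Literature.NumberTheory.Automorphic.Liu2021.Def411WeilCarriersDoubling
open Literature.NumberTheory.GelbartRogawski1991 Literature.NumberTheory.GelbartRogawski1991.UnitaryDualPair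
open Literature.RepresentationTheory.HarrisKudlaSweet1996
open Literature.NumberTheory.GaloisRepresentations (HeckeCharacter)

/-- **(C′) from the master equivalence.**  If for every CM field `L`, rank `N′`, frame `e₁`, real non-zero diagonal `dV`, unitary splitting character `χ_V`, character `χ`,
and lines `a, a′` with the same finite local norm classes there is a LINEAR EQUIVALENCE `Ψ : omegaAtLine … a χ ≃ₗ[ℂ] omegaAtLine … a′ χ` intertwining `rhoVAtLine … a χ`
and `rhoVAtLine … a′ χ` (the line-class transport MASTER of programme P4's S4a road), then the socket (C′) `rhoAtLine_lineClassTransport` holds: for every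
`ιV : G →* U(diag dV)(𝔸_{L⁺,f})`, `Ψ` is an injective intertwiner of the pulled-back representations (`rhoAtLine … ιV a χ g = rhoVAtLine … a χ (ιV g)`, `rfl`).
[cite: Liu2021, App. D §D.1 Step 1 footnote (l. 5215)] [cite: Jacobowitz1962, Thm. 3.1] [cite: MVW1987, Ch. 3 §I] [cite: HarrisKudlaSweet1996, §1 (1.14)–(1.15)] -/
theorem rhoAtLine_lineClassTransport_of_equiv
    (hLT : ∀ (L : Type) [Field L] [NumberField L] [IsCMField L] {N' n' : ℕ} (e₁ : Fin N' × Fin 1 ≃ Fin n')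
      (dV : Fin N' → L) (hdV : ∀ i, IsCMField.complexConj L (dV i) = dV i) (hdV0 : ∀ i, dV i ≠ 0)
      (χV : HeckeCharacter L) (hχu : χV.IsUnitary) (hχs : IsSplittingChar L 1 χV)
      (χ : Chi (↥(maximalRealSubfield L)) L (IsCMField.complexConj L)) (a a' : (↥(maximalRealSubfield L))ˣ),
      locF (↥(maximalRealSubfield L)) (imagUnitSq L) a = locF (↥(maximalRealSubfield L)) (imagUnitSq L) a' →
        ∃ Ψ : omegaAtLine (↥(maximalRealSubfield L)) L (IsCMField.complexConj L) N' e₁ (Matrix.diagonal dV)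
                (complexConj_imagUnit L) (imagUnit_ne_zero L) (imagUnit_mul_self L) (realDiagonal_isSymm L dV hdV)
                (isUnit_det_realDiagonal L dV hdV hdV0) (realDiagonal_map L dV hdV).symm
                (fun b => isCompatible_chiSplittingLine L e₁ dV hdV hdV0 χV hχu hχs
                  (TW (↥(maximalRealSubfield L)) b) (isSymm_TW (↥(maximalRealSubfield L)) b)
                  (isUnit_det_TW (↥(maximalRealSubfield L)) b) (JW (↥(maximalRealSubfield L)) L b)
                  (JW_eq (↥(maximalRealSubfield L)) L b))
                a χ ≃ₗ[ℂ]
              omegaAtLine (↥(maximalRealSubfield L)) L (IsCMField.complexConj L) N' e₁ (Matrix.diagonal dV)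
                (complexConj_imagUnit L) (imagUnit_ne_zero L) (imagUnit_mul_self L) (realDiagonal_isSymm L dV hdV)
                (isUnit_det_realDiagonal L dV hdV hdV0) (realDiagonal_map L dV hdV).symm
                (fun b => isCompatible_chiSplittingLine L e₁ dV hdV hdV0 χV hχu hχs
                  (TW (↥(maximalRealSubfield L)) b) (isSymm_TW (↥(maximalRealSubfield L)) b)
                  (isUnit_det_TW (↥(maximalRealSubfield L)) b) (JW (↥(maximalRealSubfield L)) L b)
                  (JW_eq (↥(maximalRealSubfield L)) L b))
                a' χ,
          ∀ (k : finAdelic (↥(maximalRealSubfield L)) L (IsCMField.complexConj L) N' (Matrix.diagonal dV)) x,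
            Ψ (rhoVAtLine (↥(maximalRealSubfield L)) L (IsCMField.complexConj L) N' e₁ (Matrix.diagonal dV)
                  (complexConj_imagUnit L) (imagUnit_ne_zero L) (imagUnit_mul_self L) (realDiagonal_isSymm L dV hdV)
                  (isUnit_det_realDiagonal L dV hdV hdV0) (realDiagonal_map L dV hdV).symm
                  (fun b => isCompatible_chiSplittingLine L e₁ dV hdV hdV0 χV hχu hχs
                    (TW (↥(maximalRealSubfield L)) b) (isSymm_TW (↥(maximalRealSubfield L)) b)
                    (isUnit_det_TW (↥(maximalRealSubfield L)) b) (JW (↥(maximalRealSubfield L)) L b)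
                    (JW_eq (↥(maximalRealSubfield L)) L b))
                  a χ k x) =
              rhoVAtLine (↥(maximalRealSubfield L)) L (IsCMField.complexConj L) N' e₁ (Matrix.diagonal dV)
                  (complexConj_imagUnit L) (imagUnit_ne_zero L) (imagUnit_mul_self L) (realDiagonal_isSymm L dV hdV)
                  (isUnit_det_realDiagonal L dV hdV hdV0) (realDiagonal_map L dV hdV).symm
                  (fun b => isCompatible_chiSplittingLine L e₁ dV hdV hdV0 χV hχu hχs
                    (TW (↥(maximalRealSubfield L)) b) (isSymm_TW (↥(maximalRealSubfield L)) b)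
                    (isUnit_det_TW (↥(maximalRealSubfield L)) b) (JW (↥(maximalRealSubfield L)) L b)
                    (JW_eq (↥(maximalRealSubfield L)) L b))
                  a' χ k (Ψ x)) :
    rhoAtLine_lineClassTransport := by
  intro L _ _ _ N' n' e₁ dV hdV hdV0 χV hχu hχs G _ _ ιV χ a a' h
  obtain ⟨Ψ, hΨ⟩ := hLT L e₁ dV hdV hdV0 χV hχu hχs χ a a' h
  exact ⟨Ψ.toLinearMap.intertwiningMap_of_isIntertwiningMap _ _ (fun g x => hΨ (ιV g) x), Ψ.injective⟩

end Summit.HodgeConjecture.HodgeConjecture.Cruxes.H413.LineClassTransport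

end
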